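import Mathlib

/-!
# The FOUR-STEP LAW (inner zigzag exclusion) — affine cores (static path model behind `KPlusLogSqLaw.TropicalB`)

Cell pub-symmetroid, seat conjb-2 (g21). A helper toward the crux `TropicalB`
(`Summit.ValiantsHypothesis.ValiantsHypothesis.Theses.KPlusLogSqLaw.TropicalB`, item
`stmt-ValiantsHypothesis-19771`); it earns no crux credit and is not evidence for `MatrixDescartes` or for
Valiant's hypothesis. Mathlib only.

THEOREM (FOUR-STEP LAW, THEORY-NOTE-g21 §3.1sexies; located first by the decision procedure `tools/lpfeas.py`, exact on
every decided table). In the static model (lines `S_t(θ) = b_t + s_t θ`, window `[u,v]` separated at `θ` iff every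
upper-class line of `[u,v]` is above every lower-class line at `θ`, `T[u,v]` its separation set, a row `j` of odd reach
`d` STEPS iff `T[j,j+d]`, `T[j+1,j+d+1]` are non-empty and disjoint): if rows `i, i+1, i+2, i+3` all step, the two
MIDDLE steps move in the same direction. Equivalently a run of `k ≥ 4` consecutive steps is «first step, monotone drift,
last step». It subsumes the alternating QUAD LAW and, with the pairwise laws and the TRIPLE LAW
(`KPlusLogSqLawStepTriple{,Cases}`), gives the located-exact FOUR-STEP PLATEAU CRITERION.

PROOF SHAPE (`i = 0`, middle pattern (right, left): `T₁ < T₂`, `T₃ < T₂`). Row exactness gives four sign facts for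
`c := S_{d+1} - S_2` (`< 0` on `T₀`, `> 0` on `T₃`) and `c' := S_3 - S_{d+2}` (`< 0` on `T₁`, `> 0` on `T₄`); the triple
laws make `c` increasing and `c'` decreasing, whence `T₀ < T₃` and `T₄ < T₁` (`incr_sign_sep`, `decr_sign_sep`). Then:
pattern (·,R,L,R) forces `T₀ < T₃ < T₄ < T₁`, i.e. the first step moves right — so (L,R,L,R) is impossible and (R,R,L,R)
is the reversal image of (L,R,L,L); pattern (L,R,L,L) dies by `four_lrll_core` (at `ρ₁ = sup T₁` the look-back partner
of line `1` is `d+1`, so `S_{d+1}(ρ₁) = S_1(ρ₁) ≤ S_2(ρ₁) ≤ S_{d+2}(ρ₁)`, while `S_{d+1} - S_{d+2}` is positive on `T₄`, left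
of `ρ₁`, and on `T₃`, right of `ρ₁`); pattern (R,R,L,L) dies by `four_rrll_core` (the binding pairs at `inf T₁` and
`inf T₃` give `c(inf T₁) ≤ 0 ≤ c'(inf T₃)`, the sign facts squeeze `inf T₁ = inf T₃ =: ι` to a common root of `c, c'`, so
`T₁ ∩ T₃ ≠ ∅`, row-`1` exactness there gives `S_2(ι) ≤ S_{d+2}(ι) = S_3(ι)`, while `S_2 - S_3 > 0` on `T₀` (left of `ι`)
and on `T₂` (right of `ι`)).

This file proves the AFFINE CORES of the two substantive cases over abstract tight points, plus the limit lemmas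
`affine_le_at_sup` / `affine_le_at_inf` and the root-separation lemmas; the window-level wrappers (binding-pair
structure at infima facing the previous window, the exactness sign facts, cf. `exact_row_gap`) are routine and left to
a sequel.
-/

set_option linter.dupNamespace false

namespace Summit.ValiantsHypothesis.ValiantsHypothesis.Theorems.KPlusLogSqLawStepFour

/-- If `S' - S` is increasing, negative at `x` and positive at `y`, then `x < y`. -/
theorem incr_sign_sep (s b s' b' x y : ℝ) (hmono : s < s') (hx : b' + s' * x < b + s * x)
    (hy : b + s * y < b' + s' * y) : x < y := by
  by_contra h
  have hyx : y ≤ x := le_of_not_gt h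
  have p : 0 ≤ (s' - s) * (x - y) := mul_nonneg (by linarith) (by linarith)
  have i1 : (b' + s' * x - (b + s * x)) - (b' + s' * y - (b + s * y)) = (s' - s) * (x - y) := by ring
  linarith

/-- If `S' - S` is decreasing, positive at `x` and negative at `y`, then `x < y`. -/
theorem decr_sign_sep (s b s' b' x y : ℝ) (hmono : s' < s) (hx : b + s * x < b' + s' * x)
    (hy : b' + s' * y < b + s * y) : x < y := by
  by_contra h
  have hyx : y ≤ x := le_of_not_gt h
  have p : 0 ≤ (s - s') * (x - y) := mul_nonneg (by linarith) (by linarith)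
  have i1 : (b + s * x - (b' + s' * x)) - (b + s * y - (b' + s' * y)) = (s - s') * (x - y) := by ring
  linarith

/-- An affine inequality holding at points approaching `r` from the left (up to `r`) holds at `r`. -/
theorem affine_le_at_sup (s b s' b' r : ℝ)
    (h : ∀ ε : ℝ, 0 < ε → ∃ θ : ℝ, b + s * θ ≤ b' + s' * θ ∧ r - ε < θ ∧ θ ≤ r) :
    b + s * r ≤ b' + s' * r := by
  by_contra hcon
  have hgap : 0 < (b + s * r) - (b' + s' * r) := by linarith
  by_cases hs : s - s' ≤ 0
  · obtain ⟨θ, hθ, h1, h2⟩ := h 1 one_pos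
    have p : 0 ≤ (s' - s) * (r - θ) := mul_nonneg (by linarith) (by linarith)
    have i1 : (b + s * θ - (b' + s' * θ)) = ((b + s * r) - (b' + s' * r)) + (s' - s) * (r - θ) := by ring
    linarith
  · have hs' : 0 < s - s' := lt_of_not_ge hs
    have hne : s - s' ≠ 0 := ne_of_gt hs'
    obtain ⟨θ, hθ, h1, h2⟩ := h (((b + s * r) - (b' + s' * r)) / (s - s')) (div_pos hgap hs')
    have hlt : (s - s') * (r - θ) < (s - s') * (((b + s * r) - (b' + s' * r)) / (s - s')) :=
      mul_lt_mul_of_pos_left (by linarith) hs'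
    have heq : (s - s') * (((b + s * r) - (b' + s' * r)) / (s - s')) = (b + s * r) - (b' + s' * r) := by
      field_simp
    have i1 : (b + s * θ - (b' + s' * θ)) = ((b + s * r) - (b' + s' * r)) - (s - s') * (r - θ) := by ring
    linarith

/-- An affine inequality holding at points approaching `r` from the right (down to `r`) holds at `r`. -/
theorem affine_le_at_inf (s b s' b' r : ℝ)
    (h : ∀ ε : ℝ, 0 < ε → ∃ θ : ℝ, b + s * θ ≤ b' + s' * θ ∧ θ < r + ε ∧ r ≤ θ) :
    b + s * r ≤ b' + s' * r := by
  have key := affine_le_at_sup (-s) b (-s') b' (-r) (fun ε hε => by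
    obtain ⟨θ, h1, h2, h3⟩ := h ε hε
    refine ⟨-θ, ?_, by linarith, by linarith⟩
    have r1 : -s * -θ = s * θ := by ring
    have r2 : -s' * -θ = s' * θ := by ring
    linarith)
  have r1 : -s * -r = s * r := by ring
  have r2 : -s' * -r = s' * r := by ring
  linarith

/-- An affine function `≤ 0` at `r` cannot be positive at a point `a ≤ r` and at a point `c ≥ r`. -/
theorem affine_three_point (g0 g1 r a c : ℝ) (hr : g0 + g1 * r ≤ 0) (ha : a ≤ r) (ha' : 0 < g0 + g1 * a)
    (hc : r ≤ c) (hc' : 0 < g0 + g1 * c) : False := by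
  rcases eq_or_lt_of_le ha with hA | hA
  · rw [hA] at ha'; linarith
  rcases eq_or_lt_of_le hc with hC | hC
  · rw [← hC] at hc'; linarith
  have i2 : (c - r) * (g0 + g1 * a) + (r - a) * (g0 + g1 * c) = (c - a) * (g0 + g1 * r) := by ring
  have p1 : 0 < (c - r) * (g0 + g1 * a) := mul_pos (by linarith) ha'
  have p2 : 0 < (r - a) * (g0 + g1 * c) := mul_pos (by linarith) hc'
  have p3 : 0 ≤ (c - a) * (-(g0 + g1 * r)) := mul_nonneg (by linarith) (by linarith)
  have i3 : (c - a) * (-(g0 + g1 * r)) = -((c - a) * (g0 + g1 * r)) := by ring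
  linarith

/-- FOUR-STEP LAW, case (L,R,L,L): the affine core. Lines: `1` = `(s1,b1)`, `2` = `(s2,b2)`, `d+1` = `(sp,bp)`,
`d+2` = `(sq,bq)`; `ρ₁ = sup T₁`. Hypotheses: the look-back partner of line `1` at `ρ₁` is `d+1` (`heq1`) with
domination (`hdom`); row-`1` exactness near `ρ₁` in the form `S_2 ≤ S_{d+2}` at points of `T₁` approaching `ρ₁`
(`happ`); a point `a` of `T₄` (left of `ρ₁`) and a point `c` of `T₃` (right of `ρ₁`) where `S_{d+1} > S_{d+2}`. -/
theorem four_lrll_core (s1 b1 s2 b2 sp bp sq bq ρ₁ a c : ℝ)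
    (heq1 : bp + sp * ρ₁ = b1 + s1 * ρ₁) (hdom : b1 + s1 * ρ₁ ≤ b2 + s2 * ρ₁)
    (happ : ∀ ε : ℝ, 0 < ε → ∃ θ : ℝ, b2 + s2 * θ ≤ bq + sq * θ ∧ ρ₁ - ε < θ ∧ θ ≤ ρ₁)
    (ha : a ≤ ρ₁) (ha' : bq + sq * a < bp + sp * a) (hc : ρ₁ ≤ c) (hc' : bq + sq * c < bp + sp * c) :
    False := by
  have h2q : b2 + s2 * ρ₁ ≤ bq + sq * ρ₁ := affine_le_at_sup s2 b2 sq bq ρ₁ happ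
  have hpq : (bp - bq) + (sp - sq) * ρ₁ ≤ 0 := by linarith
  exact affine_three_point (bp - bq) (sp - sq) ρ₁ a c hpq ha (by linarith) hc (by linarith)

/-- FOUR-STEP LAW, case (R,R,L,L): the affine core (the squeeze). Lines: `2` = `(s2,b2)`, `3` = `(s3,b3)`,
`d+1` = `(sp,bp)`, `d+2` = `(sq,bq)`; `ι₁ = inf T₁ < ρ₁ = sup T₁`, `ι₃ = inf T₃ < σ₃ = sup T₃`. Hypotheses: `c = S_{d+1} - S_2`
increasing and `c' = S_3 - S_{d+2}` decreasing (the triple laws); `c(ι₁) ≤ 0` (binding pair through `d+1` at `inf T₁`),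
`c(ι₃) ≥ 0` (closure of `c > 0` on `T₃`), `c'(ι₃) ≥ 0` (binding pair through `3` at `inf T₃`), `c'(ι₁) ≤ 0` (closure of
`c' < 0` on `T₁`); row-`1` exactness on `T₁ ∩ T₃` in the form `S_2 ≤ S_{d+2}` on `(ι₁, ρ₁) ∩ (ι₃, σ₃)`; a point `a` of `T₀`
(left of `ι₁`) and a point `c` of `T₂` (right of `ι₁`) where `S_2 > S_3`. -/
theorem four_rrll_core (s2 b2 s3 b3 sp bp sq bq ι₁ ι₃ ρ₁ σ₃ a c : ℝ)
    (hmono : s2 < sp) (hmono' : s3 < sq)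
    (hc1 : bp + sp * ι₁ ≤ b2 + s2 * ι₁) (hc3 : b2 + s2 * ι₃ ≤ bp + sp * ι₃)
    (hc'3 : bq + sq * ι₃ ≤ b3 + s3 * ι₃) (hc'1 : b3 + s3 * ι₁ ≤ bq + sq * ι₁)
    (hρ : ι₁ < ρ₁) (hσ : ι₃ < σ₃)
    (hz : ∀ θ : ℝ, ι₁ < θ → θ < ρ₁ → ι₃ < θ → θ < σ₃ → b2 + s2 * θ ≤ bq + sq * θ)
    (ha : a ≤ ι₁) (ha' : b3 + s3 * a < b2 + s2 * a) (hc : ι₁ ≤ c) (hc' : b3 + s3 * c < b2 + s2 * c) :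
    False := by
  -- the squeeze `ι₁ = ι₃`
  have h13 : ι₁ ≤ ι₃ := by
    by_contra h
    have h' : ι₃ < ι₁ := lt_of_not_ge h
    have p : 0 < (sp - s2) * (ι₁ - ι₃) := mul_pos (by linarith) (by linarith)
    have i1 : (bp + sp * ι₁ - (b2 + s2 * ι₁)) - (bp + sp * ι₃ - (b2 + s2 * ι₃)) = (sp - s2) * (ι₁ - ι₃) := by
      ring
    linarith
  have h31 : ι₃ ≤ ι₁ := by
    by_contra h
    have h' : ι₁ < ι₃ := lt_of_not_ge h
    have p : 0 < (sq - s3) * (ι₃ - ι₁) := mul_pos (by linarith) (by linarith)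
    have i1 : (bq + sq * ι₃ - (b3 + s3 * ι₃)) - (bq + sq * ι₁ - (b3 + s3 * ι₁)) = (sq - s3) * (ι₃ - ι₁) := by
      ring
    linarith
  have heq : ι₃ = ι₁ := le_antisymm h31 h13
  rw [heq] at hc'3 hσ hz
  -- `c'(ι) = 0`: `S_{d+2}(ι) = S_3(ι)`
  have hq3 : bq + sq * ι₁ = b3 + s3 * ι₁ := le_antisymm hc'3 hc'1
  -- `S_2(ι) ≤ S_{d+2}(ι)` by approximation from the right inside `T₁ ∩ T₃`
  have hle : b2 + s2 * ι₁ ≤ bq + sq * ι₁ := by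
    apply affine_le_at_inf
    intro ε hε
    have hm1 : min ε (min (ρ₁ - ι₁) (σ₃ - ι₁)) ≤ ε := min_le_left _ _
    have hm2 : min ε (min (ρ₁ - ι₁) (σ₃ - ι₁)) ≤ ρ₁ - ι₁ :=
      le_trans (min_le_right _ _) (min_le_left _ _)
    have hm3 : min ε (min (ρ₁ - ι₁) (σ₃ - ι₁)) ≤ σ₃ - ι₁ :=
      le_trans (min_le_right _ _) (min_le_right _ _)
    have hm0 : 0 < min ε (min (ρ₁ - ι₁) (σ₃ - ι₁)) :=
      lt_min hε (lt_min (by linarith) (by linarith))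
    refine ⟨ι₁ + min ε (min (ρ₁ - ι₁) (σ₃ - ι₁)) / 2, ?_, by linarith, by linarith⟩
    exact hz _ (by linarith) (by linarith) (by linarith) (by linarith)
  -- `S_2(ι) ≤ S_3(ι)` against `S_2 - S_3 > 0` at `a ≤ ι` and at `c ≥ ι`
  have hr : (b2 - b3) + (s2 - s3) * ι₁ ≤ 0 := by linarith
  exact affine_three_point (b2 - b3) (s2 - s3) ι₁ a c hr ha (by linarith) hc (by linarith)

end Summit.ValiantsHypothesis.ValiantsHypothesis.Theorems.KPlusLogSqLawStepFour
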